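import Summits.CriticalPhenomena.PercolationContinuityZ3.Theorems.PercNearOneGluingNoHeavyPcintBSMRZ6RSCert
import HarnessLib

/-!
# PCINT lane, PHASE 9 (block renewal with reach-3 pieces): kernel check 2/7 of the site certificate inequalities for `ℤ^6` at the cell `0.1900`

Cell `prim-pcint`, seat `prim-pcint-1` (gen 17); memo `run/shared/lean/prim/pcint/T-FIBRE-ROUTE.md` §PHASE 9.
Instance `Z6RS`: `d = 6 = 4 + 2` (`k = 4` time axes, the transverse plane), SITE percolation, reach-3 pieces,
7-point law `A/DA = [4, 20, 110, 732, 110, 20, 4]/1000`, horizon `N = 150` (window half-width `60`), Fourier tail (cut-off data,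
`θ₀ = 1/2`) `T = 133816970/10^12`, cell `p = 1900/10^4`. One `decide +kernel` per
representative (kernel memory), bit-mask site functional `BSMR.certFastMS`.
-/

namespace Summit.CriticalPhenomena.PercolationContinuityZ3.Theorems.Pcint.BSMR.Z6RS

open Summit.CriticalPhenomena.PercolationContinuityZ3.Theorems.Pcint.BSMR Summit.CriticalPhenomena.PercolationContinuityZ3.Theorems.Pcint.BSMX Summit.CriticalPhenomena.PercolationContinuityZ3.Theorems.Pcint.BSM

set_option maxHeartbeats 0 in
set_option maxRecDepth 65536 in
/-- The site certificate inequality at `![6, 2]` (cell `0.1900`). -/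
theorem hrep_2a : ∀ y ∈ [(![6, 2] : Fin 2 → ℤ)], certFastMS RS 4 10000 1900 7 V0t V1t (tr2 y) (shOfV (tr2 y)) ≤ Φn y * (1900 ^ 7 * 4 * 60000000 ^ 2 * (1000000000000 * 1)) := by
  decide +kernel

set_option maxHeartbeats 0 in
set_option maxRecDepth 65536 in
/-- The site certificate inequality at `![6, 1]` (cell `0.1900`). -/
theorem hrep_2b : ∀ y ∈ [(![6, 1] : Fin 2 → ℤ)], certFastMS RS 4 10000 1900 7 V0t V1t (tr2 y) (shOfV (tr2 y)) ≤ Φn y * (1900 ^ 7 * 4 * 60000000 ^ 2 * (1000000000000 * 1)) := by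
  decide +kernel

set_option maxHeartbeats 0 in
set_option maxRecDepth 65536 in
/-- The site certificate inequality at `![6, 0]` (cell `0.1900`). -/
theorem hrep_2c : ∀ y ∈ [(![6, 0] : Fin 2 → ℤ)], certFastMS RS 4 10000 1900 7 V0t V1t (tr2 y) (shOfV (tr2 y)) ≤ Φn y * (1900 ^ 7 * 4 * 60000000 ^ 2 * (1000000000000 * 1)) := by
  decide +kernel

set_option maxHeartbeats 0 in
set_option maxRecDepth 65536 in
/-- The site certificate inequality at `![5, 5]` (cell `0.1900`). -/
theorem hrep_2d : ∀ y ∈ [(![5, 5] : Fin 2 → ℤ)], certFastMS RS 4 10000 1900 7 V0t V1t (tr2 y) (shOfV (tr2 y)) ≤ Φn y * (1900 ^ 7 * 4 * 60000000 ^ 2 * (1000000000000 * 1)) := by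
  decide +kernel

/-- The site certificate inequalities on the offsets `((reps6.drop 4).take 4)` (cell `0.1900`). -/
theorem hrep_2 : ∀ y ∈ ((reps6.drop 4).take 4), certFastMS RS 4 10000 1900 7 V0t V1t (tr2 y) (shOfV (tr2 y)) ≤ Φn y * (1900 ^ 7 * 4 * 60000000 ^ 2 * (1000000000000 * 1)) := by
  intro y hy
  have hl : ((reps6.drop 4).take 4) = [(![6, 2] : Fin 2 → ℤ), (![6, 1] : Fin 2 → ℤ), (![6, 0] : Fin 2 → ℤ), (![5, 5] : Fin 2 → ℤ)] := by decide +kernel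
  rw [hl] at hy
  simp only [List.mem_cons, List.not_mem_nil, or_false] at hy
  rcases hy with rfl | rfl | rfl | rfl
  · exact hrep_2a _ (List.mem_singleton.2 rfl)
  · exact hrep_2b _ (List.mem_singleton.2 rfl)
  · exact hrep_2c _ (List.mem_singleton.2 rfl)
  · exact hrep_2d _ (List.mem_singleton.2 rfl)

end Summit.CriticalPhenomena.PercolationContinuityZ3.Theorems.Pcint.BSMR.Z6RS
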